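import Mathlib
import HarnessLib
import Summits.Langlands.Langlands.Theses.TriangulineChamber
import Literature.NumberTheory.GaloisRepresentations.PAdicHodge

/-!
# `LiftB2CrysSplitP` (item stmt-Langlands-8575) — filtration degree of the periods of `ε^m`

The first conjunct (PIN) of every `∃ RD`-slice of route `TriangulineChamber` asks that a rank-one
representation with entry `ε^m` have `τ`-labelled Hodge–Tate weights `{-m}` for the PINNED datum
`RD.pst p v hv = fontainePstAdicCompletion v p hv` (D-0018 L2).  For a rank-one representation the
labelled weights are read off a PERIOD: a unit `u` of the period ring `B = 𝔅.B` with
`σ • u = ε(σ)⁻¹ u`, the weight being the largest `i` with `u ∈ Fil^i B` (for the genuine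
`B_dR(F_v)`: `u = t⁻¹`, `Fil^i = t^i B_dR^+`).  The periods of the powers `ε^m` are the powers
`u^m`.  This file records, for an ARBITRARY period-ring datum
`𝔅 : Literature.NumberTheory.GaloisRepresentations.PeriodRingData Γ P E` (decreasing, exhaustive,
separated, multiplicative filtration on a domain), exactly what the axioms give about the
filtration degree of `u^m`:

* `periodRing_one_not_mem_fil_one` — `1 ∉ Fil¹ B` (else the filtration is constant, so
  `⊤ = ⨆ Fil = ⨅ Fil = ⊥` on a nontrivial ring);
* `periodRing_pow_mem_fil_of_mem` — from `u ∈ Fil⁻¹` ALONE (this is what clause (F2)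
  `CyclotomicWeightNegOne` of `IsFontaineDatum` provides): `u^n ∈ Fil^{-n}` for NATURAL `n`, and
  nothing about `Fil^{-n+1}` or about negative powers;
* `periodRing_zpow_mem_fil`, `periodRing_zpow_not_mem_fil`, `periodRing_zpow_mem_fil_iff` — from
  `u ∈ Fil⁻¹` AND `u⁻¹ ∈ Fil¹` (the candidate clause (F8): "`ε⁻¹` is de Rham of Hodge–Tate weight
  `+1`"): `u^m ∈ Fil^i ↔ i ≤ -m` for every integer `m`, i.e. the period of `ε^m` has filtration
  degree exactly `-m` — the combinatorial kernel of "(F2) ∧ (F8) ⇒ PIN for all `m`";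
* `pst_zpow_mem_fil_iff` — the same for the period ring `(RD.pst p v hv).𝔅` of the summit's datum
  at a place `v ∣ p` of a number field (the object the item's PIN conjunct is about).

Helpers for the item (`--supports stmt-Langlands-8575`); no statement of the route is altered and
no definition is introduced.  Axioms: `propext`, `Classical.choice`, `Quot.sound`.
-/

-- project-wide option (lakefile weak.linter.dupNamespace); `Summit.Langlands.Langlands` is mandated
set_option linter.dupNamespace false

namespace Summit.Langlands.Langlands.Theorems.LiftB2CrysSplitP

open Literature.NumberTheory.GaloisRepresentations

universe u v v' w

section PeriodRing

variable {Γ : Type u} [Group Γ] {P : Type v} {E : Type v'} [Field P] [Field E] [Algebra P E]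
  (𝔅 : PeriodRingData.{u, v, v', w} Γ P E)

/-- **`1 ∉ Fil¹ B`** for a period-ring datum [folklore]: if `1 ∈ Fil¹` then multiplicativity gives
`Fil^i ⊆ Fil^{i+1}`, so the (decreasing) filtration is constant; exhaustive and separated then
force `⊤ = ⊥`, impossible on the domain `B`.  (Equivalently: the trivial representation, whose
period is `1`, has Hodge–Tate weight exactly `0`.) -/
theorem periodRing_one_not_mem_fil_one : (1 : 𝔅.B) ∉ 𝔅.fil 1 := by
  intro h1
  -- every `Fil^i` equals `Fil^(i+1)`
  have hstep : ∀ i : ℤ, 𝔅.fil i = 𝔅.fil (i + 1) := by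
    intro i
    refine le_antisymm ?_ (𝔅.fil_antitone (by omega))
    intro x hx
    have := 𝔅.mul_mem_fil i 1 x 1 hx h1
    rwa [mul_one] at this
  have hconst : ∀ i : ℤ, 𝔅.fil i = 𝔅.fil 0 := by
    intro i
    induction i using Int.induction_on with
    | zero => rfl
    | succ n ih =>
      rw [← hstep (n : ℤ)]
      exact ih
    | pred n ih =>
      rw [hstep (-(n : ℤ) - 1), show (-(n : ℤ) - 1 + 1) = -(n : ℤ) by ring]
      exact ih
  have htop : 𝔅.fil 0 = ⊤ := by
    have h := 𝔅.iSup_fil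
    have e : (⨆ i, 𝔅.fil i) = 𝔅.fil 0 :=
      le_antisymm (iSup_le fun i => (hconst i).le) (le_iSup (fun i => 𝔅.fil i) 0)
    rwa [e] at h
  have hbot : 𝔅.fil 0 = ⊥ := by
    have h := 𝔅.iInf_fil
    have e : (⨅ i, 𝔅.fil i) = 𝔅.fil 0 :=
      le_antisymm (iInf_le (fun i => 𝔅.fil i) 0) (le_iInf fun i => (hconst i).ge)
    rwa [e] at h
  have h10 : (1 : 𝔅.B) ∈ (⊥ : Submodule E 𝔅.B) := by
    rw [← hbot, htop]
    exact Submodule.mem_top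
  rw [Submodule.mem_bot] at h10
  exact one_ne_zero h10

/-- **What (F2) alone gives** [folklore]: if the period `u` lies in `Fil⁻¹ B` then its natural
powers satisfy `u^n ∈ Fil^{-n} B` (multiplicativity).  Nothing follows about `u^n ∉ Fil^{-n+1}`
for `n ≥ 2`, nor about negative powers. -/
theorem periodRing_pow_mem_fil_of_mem (u : 𝔅.B) (hu : u ∈ 𝔅.fil (-1)) (n : ℕ) :
    u ^ n ∈ 𝔅.fil (-(n : ℤ)) := by
  induction n with
  | zero => simpa using 𝔅.one_mem_fil_zero
  | succ n ih =>
    rw [pow_succ]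
    have h := 𝔅.mul_mem_fil _ _ _ _ ih hu
    have e : (-(n : ℤ) + -1) = -((n + 1 : ℕ) : ℤ) := by push_cast; ring
    rwa [e] at h

/-- **Periods of the powers, lower bound** [folklore]: if `u ∈ Fil⁻¹ B` and `u⁻¹ ∈ Fil¹ B`
(a unit period of weight `-1` whose inverse has weight `+1`), then `u^m ∈ Fil^{-m} B` for every
integer `m`. -/
theorem periodRing_zpow_mem_fil (u : (𝔅.B)ˣ) (hu : (u : 𝔅.B) ∈ 𝔅.fil (-1))
    (hu' : ((u⁻¹ : (𝔅.B)ˣ) : 𝔅.B) ∈ 𝔅.fil 1) (m : ℤ) :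
    ((u ^ m : (𝔅.B)ˣ) : 𝔅.B) ∈ 𝔅.fil (-m) := by
  induction m using Int.induction_on with
  | zero => simpa using 𝔅.one_mem_fil_zero
  | succ n ih =>
    have h := 𝔅.mul_mem_fil (-(n : ℤ)) (-1) _ _ ih hu
    rw [zpow_add_one, Units.val_mul]
    have e : (-(n : ℤ) + -1) = -((n : ℤ) + 1) := by ring
    rwa [e] at h
  | pred n ih =>
    have h := 𝔅.mul_mem_fil (-(-(n : ℤ))) 1 _ _ ih hu'
    rw [zpow_sub_one, Units.val_mul]
    have e : (-(-(n : ℤ)) + 1) = -(-(n : ℤ) - 1) := by ring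
    rwa [e] at h

/-- **Periods of the powers, upper bound** [folklore]: under the same two hypotheses,
`u^m ∉ Fil^{-m+1} B` for every integer `m` (else `1 = u^m · u^{-m} ∈ Fil¹`, contradicting
`periodRing_one_not_mem_fil_one`). -/
theorem periodRing_zpow_not_mem_fil (u : (𝔅.B)ˣ) (hu : (u : 𝔅.B) ∈ 𝔅.fil (-1))
    (hu' : ((u⁻¹ : (𝔅.B)ˣ) : 𝔅.B) ∈ 𝔅.fil 1) (m : ℤ) :
    ((u ^ m : (𝔅.B)ˣ) : 𝔅.B) ∉ 𝔅.fil (-m + 1) := by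
  intro h
  have h' := periodRing_zpow_mem_fil 𝔅 u hu hu' (-m)
  have h1 := 𝔅.mul_mem_fil (-m + 1) (-(-m)) _ _ h h'
  rw [← Units.val_mul, ← zpow_add, show m + -m = 0 by ring, zpow_zero, Units.val_one,
    show (-m + 1 + -(-m)) = (1 : ℤ) by ring] at h1
  exact periodRing_one_not_mem_fil_one 𝔅 h1

/-- **Exact filtration degree of the periods of `ε^m`** [folklore]: for a unit `u` of the period
ring with `u ∈ Fil⁻¹ B` and `u⁻¹ ∈ Fil¹ B` (intended: `u = t⁻¹ ∈ B_dR`, the period of the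
cyclotomic character), `u^m ∈ Fil^i B ↔ i ≤ -m`.  With the dictionary "labelled Hodge–Tate weight
of a rank-one representation = filtration degree of its period" this is `HT_τ(ε^m) = {-m}` for all
`m ∈ ℤ` — the PIN conjunct of the item — from the two clauses "weight of `ε` is `-1`" (F2) and
"weight of `ε⁻¹` is `+1`" (candidate (F8)). -/
theorem periodRing_zpow_mem_fil_iff (u : (𝔅.B)ˣ) (hu : (u : 𝔅.B) ∈ 𝔅.fil (-1))
    (hu' : ((u⁻¹ : (𝔅.B)ˣ) : 𝔅.B) ∈ 𝔅.fil 1) (m i : ℤ) :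
    ((u ^ m : (𝔅.B)ˣ) : 𝔅.B) ∈ 𝔅.fil i ↔ i ≤ -m := by
  constructor
  · intro h
    by_contra hlt
    exact periodRing_zpow_not_mem_fil 𝔅 u hu hu' m
      (𝔅.fil_antitone (show -m + 1 ≤ i by omega) h)
  · intro hi
    exact 𝔅.fil_antitone hi (periodRing_zpow_mem_fil 𝔅 u hu hu' m)

/-- The hypothesis `u⁻¹ ∈ Fil¹ B` is also NECESSARY for the exact degrees [folklore]: it is the case
`m = -1` of `u^m ∈ Fil^{-m}`.  (So, granted the rank-one dictionary, "PIN for all `m`" is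
equivalent, over (F2), to the single extra clause "`ε⁻¹` has weight `+1`".) -/
theorem periodRing_inv_mem_fil_one_of_forall (u : (𝔅.B)ˣ)
    (h : ∀ m : ℤ, ((u ^ m : (𝔅.B)ˣ) : 𝔅.B) ∈ 𝔅.fil (-m)) :
    ((u⁻¹ : (𝔅.B)ˣ) : 𝔅.B) ∈ 𝔅.fil 1 := by
  simpa using h (-1)

end PeriodRing

/-! ### The period ring of the summit's datum at `v ∣ p` -/

section Summit

open NumberField IsDedekindDomain

/-- **Specialisation to the item's object** [folklore]: for the period ring `(RD.pst p v hv).𝔅` of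
the (pinned) `p`-adic Hodge datum at a place `v ∣ p` of a number field `F` and any reciprocity
datum `RD`, a unit period `u` with `u ∈ Fil⁻¹` and `u⁻¹ ∈ Fil¹` has powers of exact filtration
degree: `u^m ∈ Fil^i ↔ i ≤ -m`. -/
theorem pst_zpow_mem_fil_iff {F : Type} [Field F] [NumberField F] (p : ℕ) [Fact p.Prime]
    (RD : ReciprocityData F) (v : HeightOneSpectrum (𝓞 F)) (hv : ((p : ℕ) : 𝓞 F) ∈ v.asIdeal) :
    let D := RD.pst p v hv
    letI := D.algebra
    ∀ u : (D.𝔅.B)ˣ, (u : D.𝔅.B) ∈ D.𝔅.fil (-1) → ((u⁻¹ : (D.𝔅.B)ˣ) : D.𝔅.B) ∈ D.𝔅.fil 1 →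
      ∀ m i : ℤ, (((u ^ m : (D.𝔅.B)ˣ) : D.𝔅.B) ∈ D.𝔅.fil i ↔ i ≤ -m) := by
  intro D u hu hu' m i
  letI := D.algebra
  exact periodRing_zpow_mem_fil_iff _ u hu hu' m i

end Summit

end Summit.Langlands.Langlands.Theorems.LiftB2CrysSplitP
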